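import Summits.AtomisticToContinuum.Crystallization.Theorems.FrustratedLawDichotomyStrainedPatchTaylorSplit

/-!
# (P2a) reduced to the PAIR CHORD LEMMA: `MatchedTaylor ⟸ PairChord` (lens-5 g53, crux 27623 T-side, node T2-bent₁)

Companion of `…StrainedPatchTaylorSplit` (the five pieces of the second-order remainder node (T2-bent₁) = `…EnvelopeTaylor.TaylorTwoBent1`,
with (P1), (P3a), (P2b) and the seam `taylorTwoBent1_of_pieces : MatchedTaylor → BeyondBallTail → T2` proved there).
Here the analytic piece (P2a) `MatchedTaylor` is REDUCED to a statement about ONE pair potential along ONE chord,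
`PairChord : ∀ p Δ, ‖p‖, ‖p+Δ‖ ≥ 7/10 → ‖Δ‖ ≤ 1/10 → W(p+Δ) ≥ W(p) + DW(p)Δ − ½·Kband‖p‖·‖Δ‖²` (`W = Wrec ∘ ‖·‖`), with ALL the bookkeeping
PROVED: the matched gradient `Gmatch` equals an explicit per-pair sum of radial derivatives (`Gmatch_eq_Gexp`, via `HasFDerivAt` of each pair term and
uniqueness of the Fréchet derivative), the matched score difference is the per-pair sum of `W(p+Δ) − W(p)` over moved partners inside the ball
(`matchScore_sub`), and the linear / quadratic terms of `…EnvelopeTaylor` are the matching per-pair sums (`linMatch_eq`, `quadTerm_eq`), so that summing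
`PairChord` over the pairs gives `MatchedTaylor` (`matchedTaylor_of_pairChord`) and the seam `taylorTwoBent1_of_pairChord : PairChord → BeyondBallTail →
TaylorTwoBent1`.  `PairChord` itself is reduced further (regularity + band numerics of `W₄₅`, via the generic C^{1,1} chord lemma of `…TaylorChord`) in
`…TaylorLeaves`.
-/

open scoped BigOperators Classical
open Summit.AtomisticToContinuum.Crystallization.Theorems.FrustratedLawDichotomyRangeCut (Sep)
open Summit.AtomisticToContinuum.Crystallization.Theorems.FrustratedLawDichotomyMotifLemmas
open Summit.AtomisticToContinuum.Crystallization.Theorems.FrustratedLawDichotomyAveragingCut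
open Summit.AtomisticToContinuum.Crystallization.Theorems.FrustratedLawDichotomyAveragingRuleCap
open Summit.AtomisticToContinuum.Crystallization.Theorems.FrustratedLawDichotomyAveragingRuleTightFree
open Summit.AtomisticToContinuum.Crystallization.Theorems.FrustratedLawDichotomyExemptAbsorptionRecord
open Summit.AtomisticToContinuum.Crystallization.Theorems.FrustratedLawDichotomySchurCut
open Literature.MathematicalPhysics.StatisticalMechanics (lennardJones lennardJones_nonpos)
open Summit.AtomisticToContinuum.Crystallization.Theorems.FrustratedLawDichotomyRuleToolkitGood
open Summit.AtomisticToContinuum.Crystallization.Theorems.FrustratedLawDichotomyStrainedPatchHomSplit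
open Summit.AtomisticToContinuum.Crystallization.Theorems.FrustratedLawDichotomyStrainedPatchHomTermCalculus
open Summit.AtomisticToContinuum.Crystallization.Theorems.FrustratedLawDichotomyStrainedPatchChartFamilies
open Summit.AtomisticToContinuum.Crystallization.Theorems.FrustratedLawDichotomyStrainedPatchChartFamiliesBent
open Summit.AtomisticToContinuum.Crystallization.Theorems.FrustratedLawDichotomyStrainedPatchChartFamiliesPinned
open Summit.AtomisticToContinuum.Crystallization.Theorems.FrustratedLawDichotomyStrainedPatchEnvelopeLaw
open Summit.AtomisticToContinuum.Crystallization.Theorems.FrustratedLawDichotomyStrainedPatchEnvelopeTaylor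

open Summit.AtomisticToContinuum.Crystallization.Theorems.FrustratedLawDichotomyStrainedPatchTaylorSplit

namespace Summit.AtomisticToContinuum.Crystallization.Theorems.FrustratedLawDichotomyStrainedPatchTaylorPair

/-! ## §1. The radial potential, the pair chord lemma, the explicit matched gradient -/

/-- The pair potential as a function of the difference vector, `x ↦ W(‖x‖)`. -/
noncomputable def radW (x : E3) : ℝ := Wrec ‖x‖

/-- Its Fréchet derivative table `D(W∘‖·‖)`. -/
noncomputable def radD (x : E3) : E3 →L[ℝ] ℝ := fderiv ℝ radW x

/-- **(P2a-core) `PairChord`** [CALCULUS · C^{1,1} chord lemma · ATTACKABLE ⟸ `KbandCert` + a 1-D monotonicity lemma] — for `‖p‖, ‖p+Δ‖ ≥ 7/10` and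
`‖Δ‖ ≤ 1/10`: `W‖p‖ + D(W∘‖·‖)(p)·Δ − ½·Kband‖p‖·‖Δ‖² ≤ W‖p+Δ‖` (the chord stays at norm `≥ 0.69821`; `|g″| ≤ max(|W″|, |W′|/ρ) ≤ Kband‖p‖` there). -/
def PairChord : Prop :=
  ∀ p Δ : E3, 7 / 10 ≤ ‖p‖ → 7 / 10 ≤ ‖p + Δ‖ → ‖Δ‖ ≤ 1 / 10 → radW p + radD p Δ - Kband ‖p‖ / 2 * ‖Δ‖ ^ 2 ≤ radW (p + Δ)

/-- `x ↦ W(‖x‖)` is differentiable off `0`. [folklore] -/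
theorem hasFDerivAt_radW {x : E3} (hx : x ≠ 0) : HasFDerivAt radW (radD x) x := by
  have h : DifferentiableAt ℝ radW x := by
    unfold radW
    exact (differentiableAt_effPot45 (norm_ne_zero_iff.2 hx)).comp x (differentiableAt_id.norm ℝ hx)
  exact h.hasFDerivAt

/-- The pair-term derivative table in the position of site `b`: `E_{jk}(b) = [b = j]·D_{jk} − [b = k]·D_{jk}` (`0` on the diagonal). -/
noncomputable def Epair {M₁ : ℕ} (z₁ : Fin M₁ → E3) (j k b : Fin M₁) : E3 →L[ℝ] ℝ :=
  if j = k then 0 else (if b = j then radD (z₁ j - z₁ k) else 0) - (if b = k then radD (z₁ j - z₁ k) else 0)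

/-- Separated sites have non-zero difference. [formal bookkeeping] -/
theorem sub_ne_zero_of_sep {M₁ : ℕ} {z₁ : Fin M₁ → E3} (hz : Sep z₁) {j k : Fin M₁} (hjk : j ≠ k) : z₁ j - z₁ k ≠ 0 :=
  sub_ne_zero.2 fun h => by have := hz j k hjk; rw [h, dist_self] at this; norm_num at this

/-- Every pair term of a SEPARATED configuration, with one site `b` moved, has derivative `E_{jk}(b)` at the configuration. [folklore] -/
theorem hasFDerivAt_pair_update' {M₁ : ℕ} {z₁ : Fin M₁ → E3} (hz : Sep z₁) (j k b : Fin M₁) :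
    HasFDerivAt (fun p : E3 => Wrec (dist (Function.update z₁ b p j) (Function.update z₁ b p k))) (Epair z₁ j k b) (z₁ b) := by
  unfold Epair
  by_cases hjk : j = k
  · subst hjk
    simp only [dist_self, if_true]
    exact hasFDerivAt_const _ _
  · rw [if_neg hjk]
    have hne := sub_ne_zero_of_sep hz hjk
    by_cases hbj : b = j
    · subst hbj
      rw [if_pos rfl, if_neg hjk, sub_zero]
      simp only [Function.update_self, Function.update_of_ne (Ne.symm hjk), dist_eq_norm]
      have h := (hasFDerivAt_radW hne).comp (z₁ b) ((hasFDerivAt_id (z₁ b)).sub_const (z₁ k))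
      exact h.congr_fderiv (ContinuousLinearMap.comp_id _)
    · by_cases hbk : b = k
      · subst hbk
        rw [if_neg hbj, if_pos rfl, zero_sub]
        simp only [Function.update_self, Function.update_of_ne hjk, dist_eq_norm]
        have h := (hasFDerivAt_radW hne).comp (z₁ b) ((hasFDerivAt_id (z₁ b)).const_sub (z₁ j))
        have hL : (radD (z₁ j - z₁ b)).comp (-ContinuousLinearMap.id ℝ E3) = -radD (z₁ j - z₁ b) := by
          rw [ContinuousLinearMap.comp_neg, ContinuousLinearMap.comp_id]
        exact h.congr_fderiv hL
      · rw [if_neg hbj, if_neg hbk, sub_zero]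
        simp only [Function.update_of_ne (Ne.symm hbj), Function.update_of_ne (Ne.symm hbk)]
        exact hasFDerivAt_const _ _

/-- Division by a constant: the derivative scales. [folklore] -/
theorem hasFDerivAt_div_const {f : E3 → ℝ} {L : E3 →L[ℝ] ℝ} {x : E3} (hf : HasFDerivAt f L x) (c : ℝ) :
    HasFDerivAt (fun y => f y / c) (c⁻¹ • L) x := by
  simpa only [div_eq_mul_inv] using hf.mul_const c⁻¹

/-- The EXPLICIT matched gradient: `Σ_{j member} (#B(j))⁻¹ • ½ • Σ_{k ∈ S} E_{jk}(b)`. -/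
noncomputable def Gexp {M₁ : ℕ} (S : Finset (Fin M₁)) (z₁ : Fin M₁ → E3) (c₁ b : Fin M₁) : E3 →L[ℝ] ℝ :=
  ∑ j ∈ ball (9 / 5) z₁ c₁, (((ball (9 / 5) z₁ j).card : ℝ))⁻¹ • ((2 : ℝ)⁻¹ • ∑ k ∈ S, Epair z₁ j k b)

/-- ★ `G_S(b) = Gexp(b)` on separated instances (HasFDerivAt of the matched score, uniqueness of the derivative). [folklore] -/
theorem Gmatch_eq_Gexp {M₁ : ℕ} {z₁ : Fin M₁ → E3} (hz : Sep z₁) (S : Finset (Fin M₁)) (c₁ b : Fin M₁) : Gmatch S z₁ c₁ b = Gexp S z₁ c₁ b := by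
  unfold Gmatch Gexp matchScore matchSm
  refine HasFDerivAt.fderiv (HasFDerivAt.fun_sum fun j _ => hasFDerivAt_div_const ?_ _)
  have hin : HasFDerivAt (fun p : E3 => ∑ k ∈ S, Wrec (dist (Function.update z₁ b p j) (Function.update z₁ b p k)))
      (∑ k ∈ S, Epair z₁ j k b) (z₁ b) := HasFDerivAt.fun_sum fun k _ => hasFDerivAt_pair_update' hz j k b
  exact (hasFDerivAt_div_const (hin.sub_const _) 2).sub_const _

/-- Summing `E_{jk}(b)(d_b)` over `b ∈ S ∋ j, k`: only `b = j` and `b = k` contribute, giving `D_{jk}(d_j − d_k)`. [formal bookkeeping] -/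
theorem sum_Epair_apply {M₁ : ℕ} (z₁ : Fin M₁ → E3) {S : Finset (Fin M₁)} {j k : Fin M₁} (hj : j ∈ S) (hk : k ∈ S) (d : Fin M₁ → E3) :
    ∑ b ∈ S, Epair z₁ j k b (d b) = if j = k then 0 else radD (z₁ j - z₁ k) (d j - d k) := by
  unfold Epair
  split_ifs with hjk
  · simp
  · have h1 : ∀ b ∈ S, ((if b = j then radD (z₁ j - z₁ k) else 0) - (if b = k then radD (z₁ j - z₁ k) else 0)) (d b)
        = (if b = j then radD (z₁ j - z₁ k) (d b) else 0) - (if b = k then radD (z₁ j - z₁ k) (d b) else 0) := by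
      intro b _
      split_ifs <;> simp
    rw [Finset.sum_congr rfl h1, Finset.sum_sub_distrib, Finset.sum_ite_eq' S j, Finset.sum_ite_eq' S k, if_pos hj, if_pos hk, map_sub]

/-- On images the transported deviation is the deviation: `shiftField (e a) = dev a`. [formal bookkeeping] -/
theorem shiftField_image {t : ℝ} {M : ℕ} {z : Fin M → E3} {c : Fin M} {M₁ : ℕ} {z₁ : Fin M₁ → E3} {c₁ : Fin M₁} {e : Fin M → Fin M₁}
    (hch : ChartBy CompFamily1 tau1 t z c z₁ c₁ e) {a : Fin M} (ha : a ∈ ball (63 / 10) z c) :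
    shiftField z c z₁ c₁ e (e a) = dev z c z₁ c₁ e a := by
  simp only [shiftField, filter_fiber_eq hch ha, Finset.sum_singleton]

/-- Members are images. [formal bookkeeping] -/
theorem ball_subset_images {t : ℝ} {M : ℕ} {z : Fin M → E3} {c : Fin M} {M₁ : ℕ} {z₁ : Fin M₁ → E3} {c₁ : Fin M₁} {e : Fin M → Fin M₁}
    (hch : ChartBy CompFamily1 tau1 t z c z₁ c₁ e) : ball (9 / 5) z₁ c₁ ⊆ images z c e := by
  rw [ball_eq_image_members hch]
  exact Finset.image_subset_image (Finset.filter_subset _ _)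

/-- Re-basing a chart sum on the image set: `Σ_{a ∈ ball} Φ(e a)(dev a) = Σ_{b ∈ S} Φ(b)(shiftField b)`. [formal bookkeeping] -/
theorem sum_ball_eq_sum_images {M : ℕ} (z : Fin M → E3) (c : Fin M) {M₁ : ℕ} (z₁ : Fin M₁ → E3) (c₁ : Fin M₁) (e : Fin M → Fin M₁)
    (Φ : Fin M₁ → (E3 →L[ℝ] ℝ)) :
    ∑ a ∈ ball (63 / 10) z c, Φ (e a) (dev z c z₁ c₁ e a) = ∑ b ∈ images z c e, Φ b (shiftField z c z₁ c₁ e b) := by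
  simp only [shiftField, map_sum, images]
  rw [← Finset.sum_fiberwise_of_maps_to (fun a ha => Finset.mem_image_of_mem e ha)]
  exact Finset.sum_congr rfl fun b _ => Finset.sum_congr rfl fun a ha => by rw [(Finset.mem_filter.1 ha).2]

/-- Difference of displaced sites: `moved j − moved k = (z₁ j − z₁ k) + (d_j − d_k)`. [formal bookkeeping] -/
theorem moved_sub_moved {M : ℕ} (z : Fin M → E3) (c : Fin M) {M₁ : ℕ} (z₁ : Fin M₁ → E3) (c₁ : Fin M₁) (e : Fin M → Fin M₁) (j k : Fin M₁) :
    moved z c z₁ c₁ e j - moved z c z₁ c₁ e k = (z₁ j - z₁ k) + (shiftField z c z₁ c₁ e j - shiftField z c z₁ c₁ e k) := by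
  simp only [moved]
  abel

/-- The matched score difference as a weighted sum of pair differences. [formal bookkeeping] -/
theorem matchScore_sub {M₁ : ℕ} (S : Finset (Fin M₁)) (z₁ : Fin M₁ → E3) (c₁ : Fin M₁) (y y' : Fin M₁ → E3) :
    matchScore S z₁ c₁ y' - matchScore S z₁ c₁ y = ∑ j ∈ ball (9 / 5) z₁ c₁, ∑ k ∈ S,
      (((ball (9 / 5) z₁ j).card : ℝ))⁻¹ * (2⁻¹ * (Wrec (dist (y' j) (y' k)) - Wrec (dist (y j) (y k)))) := by
  unfold matchScore matchSm
  rw [← Finset.sum_sub_distrib]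
  refine Finset.sum_congr rfl fun j _ => ?_
  rw [← Finset.mul_sum, ← Finset.mul_sum, Finset.sum_sub_distrib]
  ring

/-- ★ `lin_{G_S}(dev)` as the explicit pair sum `Σ_j Σ_{k ∈ S} (#B j)⁻¹·½·[j ≠ k]·D_{jk}(d_j − d_k)`. [formal bookkeeping] -/
theorem linMatch_eq {t : ℝ} {M : ℕ} {z : Fin M → E3} {c : Fin M} {M₁ : ℕ} {z₁ : Fin M₁ → E3} {c₁ : Fin M₁} {e : Fin M → Fin M₁}
    (hch : ChartBy CompFamily1 tau1 t z c z₁ c₁ e) :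
    linMatch z c z₁ c₁ e = ∑ j ∈ ball (9 / 5) z₁ c₁, ∑ k ∈ images z c e, (((ball (9 / 5) z₁ j).card : ℝ))⁻¹ * (2⁻¹ *
      (if j = k then 0 else radD (z₁ j - z₁ k) (shiftField z c z₁ c₁ e j - shiftField z c z₁ c₁ e k))) := by
  have hsep : Sep z₁ := hch.1.2.1
  unfold linMatch
  rw [Finset.sum_congr rfl fun a _ => by rw [Gmatch_eq_Gexp hsep], sum_ball_eq_sum_images z c z₁ c₁ e (Gexp (images z c e) z₁ c₁)]
  simp only [Gexp, _root_.sum_apply, _root_.smul_apply, smul_eq_mul]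
  rw [Finset.sum_comm]
  refine Finset.sum_congr rfl fun j hj => ?_
  rw [← Finset.mul_sum, ← Finset.mul_sum, ← Finset.mul_sum, ← Finset.mul_sum, Finset.sum_comm]
  congr 2
  exact Finset.sum_congr rfl fun k hk => sum_Epair_apply z₁ (ball_subset_images hch hj) hk _

/-- ★ `quad_{w₀}(dev)` as the explicit pair sum `Σ_j Σ_{k ∈ S} Kband(r_jk)/(4#B j)·‖d_j − d_k‖²`. [formal bookkeeping] -/
theorem quadTerm_eq {t : ℝ} {M : ℕ} {z : Fin M → E3} {c : Fin M} {M₁ : ℕ} {z₁ : Fin M₁ → E3} {c₁ : Fin M₁} {e : Fin M → Fin M₁}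
    (hch : ChartBy CompFamily1 tau1 t z c z₁ c₁ e) :
    quadTerm w0 z c z₁ c₁ e = ∑ j ∈ ball (9 / 5) z₁ c₁, ∑ k ∈ images z c e,
      Kband (dist (z₁ j) (z₁ k)) / (4 * ((ball (9 / 5) z₁ j).card : ℝ)) * ‖shiftField z c z₁ c₁ e j - shiftField z c z₁ c₁ e k‖ ^ 2 := by
  have hinj : Set.InjOn e (ball (63 / 10) z c : Finset (Fin M)) := fun b hb b' hb' h =>
    hch.2.2.2.2.1 b b' (mem_ball.1 (Finset.mem_coe.1 hb)) (mem_ball.1 (Finset.mem_coe.1 hb')) h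
  have h1 : quadTerm w0 z c z₁ c₁ e = ∑ b ∈ images z c e, ∑ b' ∈ images z c e,
      w0 M₁ z₁ c₁ b b' * ‖shiftField z c z₁ c₁ e b - shiftField z c z₁ c₁ e b'‖ ^ 2 := by
    unfold quadTerm images
    rw [Finset.sum_image hinj]
    refine Finset.sum_congr rfl fun a ha => ?_
    rw [Finset.sum_image hinj]
    exact Finset.sum_congr rfl fun a' ha' => by rw [shiftField_image hch ha, shiftField_image hch ha']
  rw [h1]
  have h2 : ∀ b ∈ images z c e, ∑ b' ∈ images z c e, w0 M₁ z₁ c₁ b b' * ‖shiftField z c z₁ c₁ e b - shiftField z c z₁ c₁ e b'‖ ^ 2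
      = if b ∈ ball (9 / 5) z₁ c₁ then ∑ b' ∈ images z c e,
          Kband (dist (z₁ b) (z₁ b')) / (4 * ((ball (9 / 5) z₁ b).card : ℝ)) * ‖shiftField z c z₁ c₁ e b - shiftField z c z₁ c₁ e b'‖ ^ 2 else 0 := by
    intro b _
    split_ifs with hb
    · exact Finset.sum_congr rfl fun b' _ => by simp only [w0, if_pos hb]
    · exact Finset.sum_eq_zero fun b' _ => by simp only [w0, if_neg hb, zero_mul]
  rw [Finset.sum_congr rfl h2, Finset.sum_ite_mem, Finset.inter_eq_right.2 (ball_subset_images hch)]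

/-- ★★ **(P2a) ⟸ (P2a-core)**: `MatchedTaylor` from the pair chord lemma — sum the pair inequalities with weights `(#B j)⁻¹·½ ≥ 0`
(`‖p‖ ≥ 7/10` instance separation, `‖p+Δ‖ ≥ 7/10` cluster separation through `dist_moved_image`, `‖Δ‖ ≤ 2δ₀ = 1/10` fine chart). [folklore] -/
theorem matchedTaylor_of_pairChord (hPC : PairChord) : MatchedTaylor := by
  intro M z c M₁ z₁ c₁ e t hz hch hf
  have hsepz : Sep z := hz.2.1
  have hsep1 : Sep z₁ := hch.1.2.1
  have hBS := ball_subset_images hch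
  -- the per-pair inequality, already weighted
  have pair : ∀ j ∈ ball (9 / 5) z₁ c₁, ∀ k ∈ images z c e,
      (((ball (9 / 5) z₁ j).card : ℝ))⁻¹ * (2⁻¹ * (if j = k then 0 else radD (z₁ j - z₁ k) (shiftField z c z₁ c₁ e j - shiftField z c z₁ c₁ e k)))
        - Kband (dist (z₁ j) (z₁ k)) / (4 * ((ball (9 / 5) z₁ j).card : ℝ)) * ‖shiftField z c z₁ c₁ e j - shiftField z c z₁ c₁ e k‖ ^ 2
      ≤ (((ball (9 / 5) z₁ j).card : ℝ))⁻¹ * (2⁻¹ * (Wrec (dist (moved z c z₁ c₁ e j) (moved z c z₁ c₁ e k)) - Wrec (dist (z₁ j) (z₁ k)))) := by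
    intro j hj k hk
    have hc : (0 : ℝ) ≤ (((ball (9 / 5) z₁ j).card : ℝ))⁻¹ * 2⁻¹ := by positivity
    have core : (if j = k then 0 else radD (z₁ j - z₁ k) (shiftField z c z₁ c₁ e j - shiftField z c z₁ c₁ e k))
        - Kband (dist (z₁ j) (z₁ k)) / 2 * ‖shiftField z c z₁ c₁ e j - shiftField z c z₁ c₁ e k‖ ^ 2
        ≤ Wrec (dist (moved z c z₁ c₁ e j) (moved z c z₁ c₁ e k)) - Wrec (dist (z₁ j) (z₁ k)) := by
      by_cases hjk : j = k
      · subst hjk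
        simp
      · rw [if_neg hjk]
        obtain ⟨a, ha, rfl⟩ := Finset.mem_image.1 (hBS hj)
        obtain ⟨a', ha', rfl⟩ := Finset.mem_image.1 hk
        have haa' : a ≠ a' := fun h => hjk (by rw [h])
        have h1 : 7 / 10 ≤ ‖z₁ (e a) - z₁ (e a')‖ := by rw [← dist_eq_norm]; exact hsep1 _ _ hjk
        have h2 : 7 / 10 ≤ ‖(z₁ (e a) - z₁ (e a')) + (shiftField z c z₁ c₁ e (e a) - shiftField z c z₁ c₁ e (e a'))‖ := by
          rw [← moved_sub_moved, ← dist_eq_norm, dist_moved_image hch ha ha']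
          exact hsepz a a' haa'
        have h3 : ‖shiftField z c z₁ c₁ e (e a) - shiftField z c z₁ c₁ e (e a')‖ ≤ 1 / 10 := by
          rw [shiftField_image hch ha, shiftField_image hch ha']
          have := hf a (mem_ball.1 ha)
          have := hf a' (mem_ball.1 ha')
          rw [delta0] at *
          linarith [norm_sub_le (dev z c z₁ c₁ e a) (dev z c z₁ c₁ e a')]
        have h := hPC _ _ h1 h2 h3
        simp only [radW] at h
        rw [← dist_eq_norm (z₁ (e a)) (z₁ (e a')), ← moved_sub_moved, ← dist_eq_norm (moved z c z₁ c₁ e (e a)) (moved z c z₁ c₁ e (e a'))] at h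
        linarith
    have h := mul_le_mul_of_nonneg_left core hc
    have e1 : (((ball (9 / 5) z₁ j).card : ℝ))⁻¹ * 2⁻¹ * ((if j = k then 0 else radD (z₁ j - z₁ k) (shiftField z c z₁ c₁ e j - shiftField z c z₁ c₁ e k))
        - Kband (dist (z₁ j) (z₁ k)) / 2 * ‖shiftField z c z₁ c₁ e j - shiftField z c z₁ c₁ e k‖ ^ 2)
        = (((ball (9 / 5) z₁ j).card : ℝ))⁻¹ * (2⁻¹ * (if j = k then 0 else radD (z₁ j - z₁ k) (shiftField z c z₁ c₁ e j - shiftField z c z₁ c₁ e k)))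
        - Kband (dist (z₁ j) (z₁ k)) / (4 * ((ball (9 / 5) z₁ j).card : ℝ)) * ‖shiftField z c z₁ c₁ e j - shiftField z c z₁ c₁ e k‖ ^ 2 := by
      ring
    rw [e1] at h
    linarith
  have hsum := Finset.sum_le_sum fun j hj => Finset.sum_le_sum fun k hk => pair j hj k hk
  simp only [Finset.sum_sub_distrib] at hsum
  rw [← linMatch_eq hch, ← quadTerm_eq hch, ← matchScore_sub] at hsum
  linarith

/-! ## §2. The seam at pair level -/

/-- ★★ (T2-bent₁) from the pair chord lemma and the beyond-ball tail: `PairChord → BeyondBallTail → TaylorTwoBent1`. [folklore] -/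
theorem taylorTwoBent1_of_pairChord (h2 : PairChord) (h3b : BeyondBallTail) : TaylorTwoBent1 :=
  taylorTwoBent1_of_pieces (matchedTaylor_of_pairChord h2) h3b

end Summit.AtomisticToContinuum.Crystallization.Theorems.FrustratedLawDichotomyStrainedPatchTaylorPair
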